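import Literature.MathematicalPhysics.QuantumFieldTheory.Balaban1983to89.B9Eq3126KTwoBackgroundLetterTower
import Literature.MathematicalPhysics.QuantumFieldTheory.Balaban1983to89.B9Eq3126QG1QInvPointDecayTowerDiagonalClosed

/-!
# `Balaban1983to89.B9Eq3126KinvTwoBackgroundLetterTower` — T. Bałaban, *Propagators for lattice gauge theories in a background field*, Commun. Math. Phys. **99** (1985)
# 389–434 [Balaban1985BackgroundPropagators] (3.126) p. 420 *«HB = GQ*(QGQ*)⁻¹B»*, (3.132)–(3.133) p. 422, Thm 3.4 p. 400, (3.84)–(3.86) p. 407, Thm 3.11 p. 416: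
# **THE `K⁻¹`-STOREY OF THE TWO-BACKGROUND LADDERS — the local letter of `K_k(U)⁻¹ = (Q_k(U)G₁,k(U)Q_k(U)†)⁻¹` at every background of the class, and the letter of
# `K_k(U)⁻¹ − K_k(1)⁻¹` with the small factor `α`, constants BEFORE `n, η, m, U`** — for every coarse-bond field `z` supported over the bonds based at `v` with
# `‖z(c′)‖ ≤ F` and every coarse bond `c`: `‖((K_k(U)⁻¹ − K_k(1)⁻¹)z)(c)‖ ≤ K·α·e^{−κ·d_m(c₋, v)}·F`; the storey on which `H₁,k = G₁,kQ_k†K_k⁻¹` and `𝔊_k` rest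

statement-level skeleton of published theorems with citation tags; proofs where landed; nothing here is a claim about the Yang–Mills mass gap

CITATION HEADER (lean-in-tree rule).  Audit cell `pub-balaban`, sub-cell `t4`, BINDER row NE9; filed by NE9 crux-team LEAF PROVER 01 (`b2b-balaban-t4-ne9-formalise-leaf-01`, gen 101;
ROUTE (J′), the `K⁻¹` storey; bears_on: R4/N22).  Composition BY NAME: this lineage's `B9Eq3126KTwoBackgroundLetterTower.exists_letter_K_sub_flat` (gen 101, the middle factor);
ne9-leaf-03's `B9Eq3126QG1QInvPointDecayTowerDiagonalClosed.exists_bondPoint_decay_Kinv_diagonal_closed` (the coarse point decay of `K_k(U)⁻¹`), `B9Eq347LocalFromBlockDecay.local_of_block_decay`;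
ne9-leaf-05's `B9Eq326G1SupRowOfLetters.letter_comp`; ne9-leaf-01's `B9Eq349BlockMultipliers`; `B11Eq103H1Complex.{KinvLatticeK, hK_lattice}` + `mul_eq_one_comm` (the right
inverse is a left inverse).  Source READ first-hand in the held text layer `paper:balaban1985-cmp99-background-propagators` (journal page = PDF page + 388) pp. 420, 422, 400, 407.
NOTHING of print's proofs is reproduced: [folklore] second resolvent identity + two letter compositions.  THE PRINT (verbatim, p. 422): *«The operators (QGQ*)⁻¹, or (QG₁Q*)⁻¹, can be
analyzed in the same way as the operator (Q′G′²Q′*)⁻¹ …»*; p. 400 Thm 3.4: *«… small perturbations of the operators depending on U only.»*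

WHAT IS PROVED (sorry-free; proof lane — 0 `def`; [folklore]).
* §1 **`exists_letter_Kinv`** — `∃ α₀ A r > 0` BEFORE `exists_bondPoint_decay_Kinv_diagonal_closed`'s binder block (ANY onto-witness `hQ`): for every coarse-bond field `z`
  supported over `bpos⁻¹(v)` with `‖z(c′)‖ ≤ F` and every coarse bond `c`: `‖(K_k(U)⁻¹z)(c)‖ ≤ A·e^{−r·d_m(c₋,v)}·F` (`local_of_block_decay`, block mass `d·c₁`, weight `c₁`:
  price `√d`).
* §2 **`exists_letter_Kinv_sub_flat`** — THE `K⁻¹` STOREY: `∃ α₀ K κ` BEFORE the bond storey's binder block `+ hαL + (hQU, hQ1 : ANY onto-witnesses)`: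
  `‖((K_k(U)⁻¹ − K_k(1)⁻¹)z)(c)‖ ≤ K·α·e^{−κ·d_m(c₋,v)}·F` — `K_k(U)⁻¹ − K_k(1)⁻¹ = −K_k(U)⁻¹(K_k(U) − K_k(1))K_k(1)⁻¹` (`hK_lattice`, `mul_eq_one_comm`), the middle letter
  `exists_letter_K_sub_flat` between two copies of §1 (at `U` and at the vacuum), `letter_comp` twice.
HONEST SCOPE.  Composition BY NAME on the cell's MODEL rows (O-NE9-1, #5 UNRULED); constants crude (NOT print's); flat base only; first order; the smallness windows of `U`, unitarity,
the tower data, `hαL`, the positivity and onto witnesses at `U` and at `1` stay HYPOTHESES; nothing of [B9] (3.132)–(3.133) ∕ Thm 3.4 asserted as printed; «NE9 ⇐ the named binders»;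
NE9 NOT PRINTED ∕ NOT PROVED; spine PROVED 0∕9; rung (B)+1 on a finite T⁴ — NOT infinite volume, NOT mass gap, NOT BetaPertH, NOT Clay.  HONEST DEPENDENCY: continuum YM on T⁴ ⇐ BetaPertH
∧ nine spine estimates (0/9 proved); BetaPertH ⇐ (D1) ∧ (D4) ∧ CAP+tail; G-an2-4 gates asym, D1 and NE2/3/4.  NEW file; nothing modified.  Net new unproved facts: 0.
-/

noncomputable section

open scoped InnerProductSpace ComplexConjugate BigOperators

namespace Literature.MathematicalPhysics.QuantumFieldTheory.Balaban1983to89.B9Eq3126KinvTwoBackgroundLetterTower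

open B4Sect5Torus (TSite tdist tdist_nonneg tdist_triangle tdist_symm torusSum_le tdist_self)
open B4Sect5Proof (latticeConst latticeConst_nonneg)
open B9SectCLatticeCarrier (Bond bpos shift unshift shift_unshift)
open B9Eq311L2Pairing (WL2)
open B9Eq319QprimeTorus (blockCoord)
open B7Prop1Explicit (U1 Wcx boxVec)
open B11Eq103H1Complex (SiteL2K BondL2K KinvLatticeK hK_lattice)
open B9Eq310DeltaPrime (plaqHolU plaqHolU_one)
open B9Eq310HessianOperator (adTransportW hessOp)
open B9Eq315QTorus (perCfg cornerSite)
open B9Eq315QTower (towerP UlevOf)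
open B9Eq315QTowerFlat (perCfg_UlevOf_one_mem_U1 norm_Wcx_UlevOf_one_sub_one_le UlevOf_one)
open B9Eq316TowerFlatIsOneStep (towerP_eq_fineP_pow siteCast)
open B9Eq326OperatorTower (laplaceAk G1k QkW RofUk)
open B9Eq324DeltaPrimeATower (laplacePrimeAk)
open B9Eq349BlockMultipliers (exists_block_clm_family)
open B9Eq347LocalFromBlockDecay (local_of_block_decay)
open B9Eq326G1SupRowOfLetters (letter_comp)
open B9Eq3126QG1QInvPointDecayTowerDiagonalClosed (exists_bondPoint_decay_Kinv_diagonal_closed)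
open B9Eq3126KTwoBackgroundLetterTower (exists_letter_K_sub_flat)

variable {d : ℕ} (hd : 1 ≤ d) (L : ℕ) [NeZero L] (hL : 1 ≤ L) (hL3 : 3 ≤ L)
  {𝔸 : Type*} [NormedRing 𝔸] [NormedAlgebra ℂ 𝔸] [CompleteSpace 𝔸] [NormOneClass 𝔸] [StarRing 𝔸] [NormedStarGroup 𝔸] [StarModule ℂ 𝔸] [FiniteDimensional ℂ 𝔸]
  {W : Type*} [NormedAddCommGroup W] [InnerProductSpace ℂ W] [FiniteDimensional ℂ W] (φ : W ≃ₗ[ℂ] 𝔸)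
  {Mφ Mφ' : ℝ} (hMφ : 0 ≤ Mφ) (hMφ' : 0 ≤ Mφ') (hφ : ∀ w, ‖φ w‖ ≤ Mφ * ‖w‖) (hφ' : ∀ X, ‖φ.symm X‖ ≤ Mφ' * ‖X‖) (hstar : ∀ X : 𝔸, ‖star X‖ ≤ ‖X‖)
  {a : ℝ} (ha : 0 < a) {a' : ℝ} (ha' : 0 < a') {r : ℝ} (hr0 : 0 ≤ r) (hr1 : r < 1)
  (τ : 𝔸 →ₗ[ℂ] ℂ) {Cτ : ℝ} (hτ : ∀ X, ‖τ X‖ ≤ Cτ * ‖X‖) (hCτ : 0 ≤ Cτ) {Mτ : ℝ} (hτm : ∀ X Y : 𝔸, ‖τ (X * Y)‖ ≤ Mτ * ‖X‖ * ‖Y‖) (hMτ : 0 ≤ Mτ)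
  {ρw : ℝ} (hρw : 0 ≤ ρw)
  (hτ₁ : ∀ X : 𝔸, τ (star X) = conj (τ X)) (hτ₂ : ∀ X Y : 𝔸, τ (X * Y) = τ (Y * X)) (hφτ : ∀ X Y : 𝔸, ⟪φ.symm X, φ.symm Y⟫_ℂ = τ (star X * Y))
  {ι : Type} [Fintype ι] [DecidableEq ι] (b : Module.Basis ι ℝ 𝔸) {M₂ : ℝ} (hM₂ : 0 ≤ M₂) (hrepr : ∀ (v : 𝔸) (i : ι), |b.repr v i| ≤ M₂ * ‖v‖)
  (AQ : ℝ)

/-! ## §1 The local letter of `K_k(U)⁻¹` on the coarse bond carrier, from its point decay -/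

include hd hL hL3 hMφ hMφ' hφ hφ' hstar ha ha' hr0 hr1 hτ hCτ hτm hMτ hρw hτ₁ hτ₂ hφτ in
omit [FiniteDimensional ℂ 𝔸] in
set_option maxHeartbeats 1600000 in
/-- **THE LOCAL LETTER OF `K_k(U)⁻¹ = (Q_k(U)G₁,k(U)Q_k(U)†)⁻¹`** at every background of the class: `∃ α₀ A r` first; for `z` supported over the coarse bonds based at `v` with
`‖z(c′)‖ ≤ F`, `‖(K_k(U)⁻¹z)(c)‖ ≤ A·e^{−r·d_m(c₋, v)}·F` — ne9-leaf-03's point decay `‖r_{y₁}K⁻¹r_{y₀}‖ ≤ A₀e^{−r d}` read through `local_of_block_decay` at the price `√d`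
(block mass `d·c₁`, weight `c₁`). [folklore] [cite: Balaban1985BackgroundPropagators, (3.132)–(3.133) p.422, (3.49) p.399, Thm 3.11 p.416; Balaban1985Variational, (45) p.285] -/
theorem exists_letter_Kinv :
    ∃ α₀ A r₁ : ℝ, 0 < α₀ ∧ 0 ≤ A ∧ 0 < r₁ ∧
      ∀ (n : ℕ) (η : ℝ) (_hηL : η * (L : ℝ) ^ (n + 1) = 1) (c₀ c₁ : ℝ) [Fact (0 < c₀)] [Fact (0 < c₁)]
        (_hw : c₀ * ((L : ℝ) ^ (n + 1)) ^ d = c₁) (_hρ : |η| ^ d / c₀ ≤ ρw) (m : Fin d → ℕ) [∀ i, NeZero (m i)] (_hm : ∀ i, 1 ≤ m i)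
        (U : Bond d (towerP L m (n + 1)) → 𝔸ˣ) (αU : ℕ → ℝ) (_hα0 : ∀ j, 0 ≤ αU j) (hα1 : ∀ j, αU j ≤ 1 / 64)
        (_hαL : ∀ j, 50 * (d + 1) * αU j * (L : ℝ) ^ d ≤ 1 / 2)
        (hU1 : ∀ (j : ℕ) (x : B7Prop1Explicit.Site d) (k : Fin d), perCfg (towerP L m (j + 1)) (UlevOf L m (n + 1) U j) x k ∈ U1 𝔸)
        (hreg : ∀ (j : ℕ) (y : TSite d (towerP L m j)) (k : Fin d) (ρ' : Fin d → Fin L),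
          ‖((Wcx L (perCfg (towerP L m (j + 1)) (UlevOf L m (n + 1) U j)) (cornerSite L y) k (boxVec L ρ') : 𝔸ˣ) : 𝔸) - 1‖ ≤ αU j)
        (εU : ℕ → ℝ) (_hεU : ∀ j, 0 ≤ εU j) (_hUε : ∀ (j : ℕ) (b : Bond d (towerP L m (j + 1))), ‖(UlevOf L m (n + 1) U j b : 𝔸) - 1‖ ≤ εU j)
        (_hLb : ∀ (j : ℕ) (b : Bond d (towerP L m (j + 1))), UlevOf L m (n + 1) U j b ∈ U1 𝔸)
        (α : ℝ) (_hα : 0 ≤ α) (_hαle : α ≤ α₀)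
        (_hUst : ∀ b, star (U b : 𝔸) = (((U b)⁻¹ : 𝔸ˣ) : 𝔸)) (_hUb : ∀ b, U b ∈ U1 𝔸) (_hUη : ∀ b, ‖(U b : 𝔸) - 1‖ ≤ α * η)
        (_hpl : ∀ p : B9SectCLatticeCarrier.Plaq d (towerP L m (n + 1)), ‖(plaqHolU U p : 𝔸) - 1‖ ≤ α * η ^ 2)
        (_hεg : ∀ j < n + 1, εU j ≤ α * r ^ j)
        (hpos : ∀ x : BondL2K ℂ d (towerP L m (n + 1)) c₀ W, x ≠ 0 →
          0 < RCLike.re ⟪x, laplaceAk L m n φ η U hL αU hα1 hU1 hreg τ (c₀ := c₀) (c₁ := c₁) a x⟫_ℂ)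
        (hQ : Function.Surjective (QkW L m n φ U hL αU hα1 hU1 hreg (c₀ := c₀) (c₁ := c₁)))
        (v : TSite d m) (z : BondL2K ℂ d m c₁ W) (F : ℝ)
        (_hzv : ∀ c', bpos c' ≠ v → WL2.equiv ℂ (fun _ : Bond d m => c₁) W z c' = 0)
        (_hzF : ∀ c', ‖WL2.equiv ℂ (fun _ : Bond d m => c₁) W z c'‖ ≤ F) (c : Bond d m),
        ‖WL2.equiv ℂ (fun _ : Bond d m => c₁) W (KinvLatticeK hpos hQ z) c‖ ≤ A * Real.exp (-(r₁ * tdist m (bpos c) v)) * F := by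
  classical
  obtain ⟨αK, r₁, AK, hαK, hr₁, hAK, HK⟩ := exists_bondPoint_decay_Kinv_diagonal_closed hd L hL hL3 φ hMφ hMφ' hφ hφ' hstar ha ha' hr0 hr1 τ hτ hCτ hτm
    hMτ hρw hτ₁ hτ₂ hφτ
  refine ⟨αK, AK * Real.sqrt d, r₁, hαK, by positivity, hr₁, ?_⟩
  intro n η hηL c₀ c₁ _ _ hw hρ m _ hm U αU hα0 hα1 hαL hU1 hreg εU hεU hUε hLb α hα hαle hUst hUb hUη hpl hεg hpos hQ v z F hzv hzF c
  have hc₁ : (0 : ℝ) < c₁ := Fact.out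
  haveI : Nonempty (Bond d m) := ⟨(v, ⟨0, hd⟩)⟩
  obtain ⟨rF, hrF⟩ := exists_block_clm_family (𝕜 := ℂ) (w := fun _ : Bond d m => c₁) (V := W) (fun c' : Bond d m => bpos c')
  obtain ⟨Kcl, hKcl⟩ : ∃ T : BondL2K ℂ d m c₁ W →L[ℂ] BondL2K ℂ d m c₁ W, T = LinearMap.toContinuousLinearMap (KinvLatticeK hpos hQ) := ⟨_, rfl⟩
  have hdec : ∀ u w : TSite d m, ‖rF u ∘L Kcl ∘L rF w‖ ≤ AK * Real.exp (-(r₁ * tdist m u w)) := fun u w => by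
    rw [hKcl, tdist_symm hm]
    exact HK n η hηL c₀ c₁ hw hρ m hm U αU hα0 hα1 hαL hU1 hreg εU hεU hUε hLb α hα hαle hUst hUb hUη hpl hεg hpos hQ rF hrF w u
  have hμF : ∀ u : TSite d m, ∑ x : Bond d m, (if bpos x = u then c₁ else 0) ≤ (d : ℝ) * c₁ := by
    intro u
    rw [Fintype.sum_prod_type, Finset.sum_comm]
    have hin : ∀ μ : Fin d, ∑ y : TSite d m, (if bpos ((y, μ) : Bond d m) = u then c₁ else 0) = c₁ := fun μ => by
      simp only [show ∀ y : TSite d m, bpos ((y, μ) : Bond d m) = y from fun _ => rfl, Finset.sum_ite_eq', Finset.mem_univ, if_true]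
    simp only [hin, Finset.sum_const, Finset.card_univ, Fintype.card_fin, nsmul_eq_mul, le_refl]
  have h := local_of_block_decay (π := fun c' : Bond d m => bpos c') (π' := fun c' : Bond d m => bpos c') hrF hrF Kcl (tdist m) hAK hc₁ (fun _ => le_rfl) hμF
    hdec v z F hzv hzF c
  rw [hKcl, LinearMap.coe_toContinuousLinearMap'] at h
  refine h.trans (le_of_eq ?_)
  rw [Real.sqrt_mul (Nat.cast_nonneg d), mul_div_assoc, mul_div_assoc, div_self (Real.sqrt_pos.2 hc₁).ne', mul_one]


/-! ## §2 The `K⁻¹` storey: the letter of `K_k(U)⁻¹ − K_k(1)⁻¹` with the small factor -/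

include hd hL hL3 hMφ hMφ' hφ hφ' hstar ha ha' hr0 hr1 hτ hCτ hτm hMτ hρw hτ₁ hτ₂ hφτ hM₂ hrepr in
set_option maxHeartbeats 3200000 in
set_option maxRecDepth 8192 in
/-- **THE `K⁻¹` STOREY OF THE TWO-BACKGROUND LADDERS** — see the module docstring: `‖((K_k(U)⁻¹ − K_k(1)⁻¹)z)(c)‖ ≤ K·α·e^{−κ·d_m(c₋,v)}·F` for coarse-bond sources over
one base point, constants before the lattice; second resolvent identity, the middle letter of `B9Eq3126KTwoBackgroundLetterTower`, the outer letters of §1 at `U` and at `1`.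
[folklore] [cite: Balaban1985BackgroundPropagators, (3.126) p.420, (3.132)–(3.133) p.422, Thm 3.4 p.400, (3.84)–(3.86) p.407, Thm 3.11 p.416] -/
theorem exists_letter_Kinv_sub_flat :
    ∃ α₀ K κ : ℝ, 0 < α₀ ∧ 0 ≤ K ∧ 0 < κ ∧
      ∀ (n : ℕ) (η : ℝ), η * (L : ℝ) ^ (n + 1) = 1 →
      ∀ (c₀ c₁ : ℝ) [Fact (0 < c₀)] [Fact (0 < c₁)], c₀ * ((L : ℝ) ^ (n + 1)) ^ d = c₁ → |η| ^ d / c₀ ≤ ρw →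
      ∀ (m : Fin d → ℕ) [∀ i, NeZero (m i)], (∀ i, 1 ≤ m i) → ∀ (U : Bond d (towerP L m (n + 1)) → 𝔸ˣ) (α : ℝ), 0 ≤ α → α ≤ α₀ →
        (∀ bd, U bd ∈ U1 𝔸) → (∀ bd, ‖(U bd : 𝔸) - 1‖ ≤ α * η) →
        (∀ (x : TSite d (towerP L m (n + 1))) (μ ν : Fin d), ‖(U (shift ν x, μ) : 𝔸) - (U (x, μ) : 𝔸)‖ ≤ α * η ^ 2) →
        (∀ p : B9SectCLatticeCarrier.Plaq d (towerP L m (n + 1)), ‖(plaqHolU U p : 𝔸) - 1‖ ≤ α * η ^ 2) →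
      ∀ (hUst : ∀ bd, star (U bd : 𝔸) = (((U bd)⁻¹ : 𝔸ˣ) : 𝔸))
        (αU : ℕ → ℝ), (∀ j, 0 ≤ αU j) → ∀ (hα1 : ∀ j, αU j ≤ 1 / 64), (∀ j, 50 * (d + 1) * αU j * (L : ℝ) ^ d ≤ 1 / 2) →
        (∑ j ∈ Finset.range (n + 1), αU j ≤ AQ) →
        ∀ (hU1 : ∀ (j : ℕ) (x : B7Prop1Explicit.Site d) (k : Fin d), perCfg (towerP L m (j + 1)) (UlevOf L m (n + 1) U j) x k ∈ U1 𝔸)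
        (hreg : ∀ (j : ℕ) (y : TSite d (towerP L m j)) (k : Fin d) (ρ' : Fin d → Fin L),
          ‖((Wcx L (perCfg (towerP L m (j + 1)) (UlevOf L m (n + 1) U j)) (cornerSite L y) k (boxVec L ρ') : 𝔸ˣ) : 𝔸) - 1‖ ≤ αU j),
      ∀ (εU : ℕ → ℝ), (∀ j, 0 ≤ εU j) → (∀ j, εU j ≤ 1) → (∀ j < n + 1, εU j ≤ α * r ^ j) →
        (∀ (j : ℕ) (bd : Bond d (towerP L m (j + 1))), ‖(UlevOf L m (n + 1) U j bd : 𝔸) - 1‖ ≤ εU j) →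
        (∀ (j : ℕ) (bd : Bond d (towerP L m (j + 1))), UlevOf L m (n + 1) U j bd ∈ U1 𝔸) →
        (∀ (j : ℕ) (bd : Bond d (towerP L m (j + 1))) (w : W), ‖adTransportW φ (UlevOf L m (n + 1) U j) bd w‖ ≤ ‖w‖) →
      ∀ (hposU' : ∀ x : SiteL2K ℂ d (towerP L m (n + 1)) c₀ W, x ≠ 0 → 0 < RCLike.re ⟪x, laplacePrimeAk L m n φ η U a' (c₁ := c₁) x⟫_ℂ)
        (hposU : ∀ x : BondL2K ℂ d (towerP L m (n + 1)) c₀ W, x ≠ 0 →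
          0 < RCLike.re ⟪x, laplaceAk L m n φ η U hL αU hα1 hU1 hreg τ (c₀ := c₀) (c₁ := c₁) a x⟫_ℂ)
        (hpos'₁ : ∀ x : SiteL2K ℂ d (towerP L m (n + 1)) c₀ W, x ≠ 0 →
          0 < RCLike.re ⟪x, laplacePrimeAk L m n φ η (fun _ : Bond d (towerP L m (n + 1)) => (1 : 𝔸ˣ)) a' (c₁ := c₁) x⟫_ℂ)
        (hpos₁ : ∀ x : BondL2K ℂ d (towerP L m (n + 1)) c₀ W, x ≠ 0 →
          0 < RCLike.re ⟪x, laplaceAk L m n φ η (fun _ : Bond d (towerP L m (n + 1)) => (1 : 𝔸ˣ)) hL (fun _ => 0) (fun _ => by norm_num)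
            (perCfg_UlevOf_one_mem_U1 L m (n + 1)) (norm_Wcx_UlevOf_one_sub_one_le L m (n + 1) (fun _ => 0) (fun _ => le_rfl)) τ
            (c₀ := c₀) (c₁ := c₁) a x⟫_ℂ)
        (hQU : Function.Surjective (QkW L m n φ U hL αU hα1 hU1 hreg (c₀ := c₀) (c₁ := c₁)))
        (hQ1 : Function.Surjective (QkW L m n φ (fun _ : Bond d (towerP L m (n + 1)) => (1 : 𝔸ˣ)) hL (fun _ => 0) (fun _ => by norm_num)
          (perCfg_UlevOf_one_mem_U1 L m (n + 1)) (norm_Wcx_UlevOf_one_sub_one_le L m (n + 1) (fun _ => 0) (fun _ => le_rfl)) (c₀ := c₀) (c₁ := c₁))),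
      ∀ (v : TSite d m) (z : BondL2K ℂ d m c₁ W) (F : ℝ),
        (∀ c', bpos c' ≠ v → WL2.equiv ℂ (fun _ : Bond d m => c₁) W z c' = 0) →
        (∀ c', ‖WL2.equiv ℂ (fun _ : Bond d m => c₁) W z c'‖ ≤ F) →
      ∀ c : Bond d m,
        ‖WL2.equiv ℂ (fun _ : Bond d m => c₁) W (KinvLatticeK hposU hQU z -
              KinvLatticeK (c := ((η : ℂ))⁻¹) (R := adTransportW φ (fun _ : Bond d (towerP L m (n + 1)) => (1 : 𝔸ˣ)))
                (S := adTransportW φ fun _ : Bond d (towerP L m (n + 1)) => (1 : 𝔸ˣ)⁻¹) (Δ₁ := hessOp φ η (fun _ : Bond d (towerP L m (n + 1)) => (1 : 𝔸ˣ)) τ)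
                (Rr := RofUk L m n φ η (fun _ : Bond d (towerP L m (n + 1)) => (1 : 𝔸ˣ)))
                (Q := (QkW L m n φ (fun _ : Bond d (towerP L m (n + 1)) => (1 : 𝔸ˣ)) hL (fun _ => 0) (fun _ => by norm_num)
                  (perCfg_UlevOf_one_mem_U1 L m (n + 1)) (norm_Wcx_UlevOf_one_sub_one_le L m (n + 1) (fun _ => 0) (fun _ => le_rfl)) (c₀ := c₀) (c₁ := c₁))) (a := a)
                hpos₁ hQ1 z) c‖ ≤
          K * α * Real.exp (-(κ * tdist m (bpos c) v)) * F := by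
  classical
  obtain ⟨αA, KA, κA, hαA, hKA, hκA, HA⟩ :=
    exists_letter_K_sub_flat hd L hL hL3 φ hMφ hMφ' hφ hφ' hstar ha ha' hr0 hr1 τ hτ hCτ hτm hMτ hρw hτ₁ hτ₂ hφτ b hM₂ hrepr AQ
  obtain ⟨αK, AK, rK, hαK, hAK, hrK, HK⟩ :=
    exists_letter_Kinv hd L hL hL3 φ hMφ hMφ' hφ hφ' hstar ha ha' hr0 hr1 τ hτ hCτ hτm hMτ hρw hτ₁ hτ₂ hφτ
  set ρ₀ : ℝ := min κA rK with hρ₀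
  have hρ₀0 : 0 < ρ₀ := lt_min hκA hrK
  have hρ₀A : ρ₀ ≤ κA := min_le_left _ _
  have hρ₀K : ρ₀ ≤ rK := min_le_right _ _
  set S : ℝ := latticeConst d (ρ₀ / 2) with hS
  have hS0 : 0 ≤ S := latticeConst_nonneg d (half_pos hρ₀0).le
  refine ⟨min αA αK, AK * KA * S * AK * S, ρ₀ / 2, lt_min hαA hαK, by positivity, half_pos hρ₀0, ?_⟩
  intro n η hηL c₀ c₁ _ _ hw hρ m _ hm U α hα hαle hUb hUη hUw hpl hUst αU hα0U hα1 hαL hAQ hU1 hreg εU hε0 hε1 hεr hlev hlev1 hRlev hposU' hposU hpos'₁ hpos₁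
    hQU hQ1 v z F hzv hzF c
  have hαA' : α ≤ αA := hαle.trans (min_le_left _ _)
  have hαK' : α ≤ αK := hαle.trans (min_le_right _ _)
  haveI : Nonempty (Bond d m) := ⟨(v, ⟨0, hd⟩)⟩
  have hF : 0 ≤ F := (norm_nonneg _).trans (hzF c)
  -- names
  set piC : Bond d m → TSite d m := fun c' => c'.1 with hpiC
  set GU := G1k L m n φ η U hL αU hα1 hU1 hreg τ (c₀ := c₀) (c₁ := c₁) hposU with hGU
  set G1 := G1k L m n φ η (fun _ : Bond d (towerP L m (n + 1)) => (1 : 𝔸ˣ)) hL (fun _ => 0) (fun _ => by norm_num)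
    (perCfg_UlevOf_one_mem_U1 L m (n + 1)) (norm_Wcx_UlevOf_one_sub_one_le L m (n + 1) (fun _ => 0) (fun _ => le_rfl)) τ (c₀ := c₀) (c₁ := c₁) hpos₁ with hG1
  set QU := QkW L m n φ U hL αU hα1 hU1 hreg (c₀ := c₀) (c₁ := c₁) with hQU'
  set Q1 := QkW L m n φ (fun _ : Bond d (towerP L m (n + 1)) => (1 : 𝔸ˣ)) hL (fun _ => 0) (fun _ => by norm_num)
    (perCfg_UlevOf_one_mem_U1 L m (n + 1)) (norm_Wcx_UlevOf_one_sub_one_le L m (n + 1) (fun _ => 0) (fun _ => le_rfl)) (c₀ := c₀) (c₁ := c₁) with hQ1'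
  set KU := KinvLatticeK hposU hQU with hKU
  set K1 := KinvLatticeK (c := ((η : ℂ))⁻¹) (R := adTransportW φ (fun _ : Bond d (towerP L m (n + 1)) => (1 : 𝔸ˣ)))
                (S := adTransportW φ fun _ : Bond d (towerP L m (n + 1)) => (1 : 𝔸ˣ)⁻¹) (Δ₁ := hessOp φ η (fun _ : Bond d (towerP L m (n + 1)) => (1 : 𝔸ˣ)) τ)
                (Rr := RofUk L m n φ η (fun _ : Bond d (towerP L m (n + 1)) => (1 : 𝔸ˣ)))
                (Q := (QkW L m n φ (fun _ : Bond d (towerP L m (n + 1)) => (1 : 𝔸ˣ)) hL (fun _ => 0) (fun _ => by norm_num)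
                  (perCfg_UlevOf_one_mem_U1 L m (n + 1)) (norm_Wcx_UlevOf_one_sub_one_le L m (n + 1) (fun _ => 0) (fun _ => le_rfl)) (c₀ := c₀) (c₁ := c₁))) (a := a)
                hpos₁ hQ1 with hK1
  -- the CLMs
  obtain ⟨KUcl, hKUcl⟩ : ∃ T : BondL2K ℂ d m c₁ W →L[ℂ] BondL2K ℂ d m c₁ W, T = LinearMap.toContinuousLinearMap KU := ⟨_, rfl⟩
  obtain ⟨K1cl, hK1cl⟩ : ∃ T : BondL2K ℂ d m c₁ W →L[ℂ] BondL2K ℂ d m c₁ W, T = LinearMap.toContinuousLinearMap K1 := ⟨_, rfl⟩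
  obtain ⟨Xcl, hXcl⟩ : ∃ T : BondL2K ℂ d m c₁ W →L[ℂ] BondL2K ℂ d m c₁ W,
      T = LinearMap.toContinuousLinearMap ((QU ∘ₗ GU ∘ₗ LinearMap.adjoint QU) - (Q1 ∘ₗ G1 ∘ₗ LinearMap.adjoint Q1)) := ⟨_, rfl⟩
  -- (1) the flat class data for §1 at the vacuum
  have hUε1 : ∀ (j : ℕ) (b' : Bond d (towerP L m (j + 1))), ‖(UlevOf L m (n + 1) (fun _ : Bond d (towerP L m (n + 1)) => (1 : 𝔸ˣ)) j b' : 𝔸) - 1‖ ≤ (fun _ : ℕ => (0 : ℝ)) j :=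
    fun j b' => by rw [UlevOf_one]; simp
  have hLb1 : ∀ (j : ℕ) (b' : Bond d (towerP L m (j + 1))), UlevOf L m (n + 1) (fun _ : Bond d (towerP L m (n + 1)) => (1 : 𝔸ˣ)) j b' ∈ U1 𝔸 := fun j b' => by
    rw [UlevOf_one]; exact one_mem _
  have hUst1 : ∀ b' : Bond d (towerP L m (n + 1)), star ((fun _ : Bond d (towerP L m (n + 1)) => (1 : 𝔸ˣ)) b' : 𝔸) =
      ((((fun _ : Bond d (towerP L m (n + 1)) => (1 : 𝔸ˣ)) b')⁻¹ : 𝔸ˣ) : 𝔸) := fun _ => by simp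
  have hUb1 : ∀ b' : Bond d (towerP L m (n + 1)), (fun _ : Bond d (towerP L m (n + 1)) => (1 : 𝔸ˣ)) b' ∈ U1 𝔸 := fun _ => one_mem _
  have hUη1 : ∀ b' : Bond d (towerP L m (n + 1)), ‖((fun _ : Bond d (towerP L m (n + 1)) => (1 : 𝔸ˣ)) b' : 𝔸) - 1‖ ≤ 0 * η := fun _ => by simp
  have hpl1 : ∀ p : B9SectCLatticeCarrier.Plaq d (towerP L m (n + 1)), ‖(plaqHolU (fun _ : Bond d (towerP L m (n + 1)) => (1 : 𝔸ˣ)) p : 𝔸) - 1‖ ≤ 0 * η ^ 2 := fun _ => by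
    simp [plaqHolU_one]
  have hεg1 : ∀ j < n + 1, (fun _ : ℕ => (0 : ℝ)) j ≤ 0 * r ^ j := fun _ _ => by simp
  have hαL1 : ∀ j : ℕ, 50 * (d + 1) * (fun _ : ℕ => (0 : ℝ)) j * (L : ℝ) ^ d ≤ 1 / 2 := fun _ => by norm_num
  -- (2) the three letters at the common rate `ρ₀`
  have hweak : ∀ {r' : ℝ} (t : ℝ), ρ₀ ≤ r' → 0 ≤ t → Real.exp (-(r' * t)) ≤ Real.exp (-(ρ₀ * t)) := fun t hr ht => Real.exp_le_exp.mpr (by nlinarith)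
  have hLKU : ∀ (w : TSite d m) (h : BondL2K ℂ d m c₁ W) (H : ℝ), (∀ c', piC c' ≠ w → WL2.equiv ℂ (fun _ : Bond d m => c₁) W h c' = 0) →
      (∀ c', ‖WL2.equiv ℂ (fun _ : Bond d m => c₁) W h c'‖ ≤ H) →
      ∀ c', ‖WL2.equiv ℂ (fun _ : Bond d m => c₁) W (KUcl h) c'‖ ≤ AK * Real.exp (-(ρ₀ * tdist m (piC c') w)) * H := by
    intro w h H hhv hhF c'
    have hH : 0 ≤ H := (norm_nonneg _).trans (hhF c')
    rw [hKUcl, LinearMap.coe_toContinuousLinearMap']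
    refine (HK n η hηL c₀ c₁ hw hρ m hm U αU hα0U hα1 hαL hU1 hreg εU hε0 hlev hlev1 α hα hαK' hUst hUb hUη hpl hεr hposU hQU w h H hhv hhF c').trans ?_
    exact mul_le_mul_of_nonneg_right (mul_le_mul_of_nonneg_left (hweak _ hρ₀K (tdist_nonneg m _ _)) hAK) hH
  have hLK1 : ∀ (w : TSite d m) (h : BondL2K ℂ d m c₁ W) (H : ℝ), (∀ c', piC c' ≠ w → WL2.equiv ℂ (fun _ : Bond d m => c₁) W h c' = 0) →
      (∀ c', ‖WL2.equiv ℂ (fun _ : Bond d m => c₁) W h c'‖ ≤ H) →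
      ∀ c', ‖WL2.equiv ℂ (fun _ : Bond d m => c₁) W (K1cl h) c'‖ ≤ AK * Real.exp (-(ρ₀ * tdist m (piC c') w)) * H := by
    intro w h H hhv hhF c'
    have hH : 0 ≤ H := (norm_nonneg _).trans (hhF c')
    rw [hK1cl, LinearMap.coe_toContinuousLinearMap']
    refine (HK n η hηL c₀ c₁ hw hρ m hm (fun _ : Bond d (towerP L m (n + 1)) => (1 : 𝔸ˣ)) (fun _ => 0) (fun _ => le_rfl) (fun _ => by norm_num) hαL1
      (perCfg_UlevOf_one_mem_U1 L m (n + 1)) (norm_Wcx_UlevOf_one_sub_one_le L m (n + 1) (fun _ => 0) (fun _ => le_rfl)) (fun _ => 0) (fun _ => le_rfl) hUε1 hLb1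
      0 le_rfl hαK.le hUst1 hUb1 hUη1 hpl1 hεg1 hpos₁ hQ1 w h H hhv hhF c').trans ?_
    exact mul_le_mul_of_nonneg_right (mul_le_mul_of_nonneg_left (hweak _ hρ₀K (tdist_nonneg m _ _)) hAK) hH
  have hLX : ∀ (w : TSite d m) (h : BondL2K ℂ d m c₁ W) (H : ℝ), (∀ c', piC c' ≠ w → WL2.equiv ℂ (fun _ : Bond d m => c₁) W h c' = 0) →
      (∀ c', ‖WL2.equiv ℂ (fun _ : Bond d m => c₁) W h c'‖ ≤ H) →
      ∀ c', ‖WL2.equiv ℂ (fun _ : Bond d m => c₁) W (Xcl h) c'‖ ≤ (KA * α) * Real.exp (-(ρ₀ * tdist m (piC c') w)) * H := by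
    intro w h H hhv hhF c'
    have hH : 0 ≤ H := (norm_nonneg _).trans (hhF c')
    rw [hXcl, LinearMap.coe_toContinuousLinearMap', LinearMap.sub_apply, LinearMap.comp_apply, LinearMap.comp_apply, LinearMap.comp_apply, LinearMap.comp_apply]
    refine (HA n η hηL c₀ c₁ hw hρ m hm U α hα hαA' hUb hUη hUw hpl hUst αU hα0U hα1 hAQ hU1 hreg εU hε0 hε1 hεr hlev hlev1 hRlev hposU' hposU hpos'₁ hpos₁
      w h H hhv hhF c').trans ?_
    exact mul_le_mul_of_nonneg_right (mul_le_mul_of_nonneg_left (hweak _ hρ₀A (tdist_nonneg m _ _)) (mul_nonneg hKA hα)) hH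
  -- (3) the two compositions
  have hrow : ∀ w : TSite d m, ∑ u, Real.exp (-((ρ₀ - ρ₀ / 2) * tdist m w u)) ≤ S := fun w => by
    rw [show ρ₀ - ρ₀ / 2 = ρ₀ / 2 by ring]; exact torusSum_le d hm (half_pos hρ₀0) w
  have hδ0 : ∀ u v : TSite d m, 0 ≤ tdist m u v := fun u v => tdist_nonneg _ _ _
  have hδt : ∀ u y v : TSite d m, tdist m u v ≤ tdist m u y + tdist m y v := fun u y v => tdist_triangle hm u y v
  have hκ'0 : (0 : ℝ) ≤ ρ₀ / 2 := by positivity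
  have hκ'1 : ρ₀ / 2 ≤ ρ₀ := by linarith
  have hc1 := letter_comp (𝕜 := ℂ) (tdist m) piC piC piC K1cl Xcl hδ0 hδt hAK (mul_nonneg hKA hα) hκ'0 hκ'1 hLK1 hLX hrow
  have hc2 := letter_comp (𝕜 := ℂ) (tdist m) piC piC piC (Xcl ∘L K1cl) KUcl hδ0 hδt (by positivity) hAK hκ'0 le_rfl hc1 hLKU hrow v z F hzv hzF c
  -- (4) the second resolvent identity `K(U)⁻¹ − K(1)⁻¹ = −K(U)⁻¹(K(U) − K(1))K(1)⁻¹`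
  have hR1 : Q1 (G1 (LinearMap.adjoint Q1 (K1 z))) = z :=
    hK_lattice (c := ((η : ℂ))⁻¹) (R := adTransportW φ (fun _ : Bond d (towerP L m (n + 1)) => (1 : 𝔸ˣ)))
      (S := adTransportW φ fun _ : Bond d (towerP L m (n + 1)) => (1 : 𝔸ˣ)⁻¹) (Δ₁ := hessOp φ η (fun _ : Bond d (towerP L m (n + 1)) => (1 : 𝔸ˣ)) τ)
      (Rr := RofUk L m n φ η (fun _ : Bond d (towerP L m (n + 1)) => (1 : 𝔸ˣ)))
      (Q := (QkW L m n φ (fun _ : Bond d (towerP L m (n + 1)) => (1 : 𝔸ˣ)) hL (fun _ => 0) (fun _ => by norm_num)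
        (perCfg_UlevOf_one_mem_U1 L m (n + 1)) (norm_Wcx_UlevOf_one_sub_one_le L m (n + 1) (fun _ => 0) (fun _ => le_rfl)) (c₀ := c₀) (c₁ := c₁))) (a := a)
      hpos₁ hQ1 z
  have hRU : (QU ∘ₗ GU ∘ₗ LinearMap.adjoint QU) * KU = 1 := by
    apply LinearMap.ext
    intro y
    exact hK_lattice hposU hQU y
  have hLU : KU * (QU ∘ₗ GU ∘ₗ LinearMap.adjoint QU) = 1 := mul_eq_one_comm.mp hRU
  have hLU' : KU (QU (GU (LinearMap.adjoint QU (K1 z)))) = K1 z := by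
    have e := congrArg (fun T : BondL2K ℂ d m c₁ W →ₗ[ℂ] BondL2K ℂ d m c₁ W => T (K1 z)) hLU
    simpa only [Module.End.mul_apply, LinearMap.comp_apply, Module.End.one_apply] using e
  have e3 : KU z = KU (Q1 (G1 (LinearMap.adjoint Q1 (K1 z)))) := by rw [hR1]
  have eX : ∀ w, Xcl w = QU (GU (LinearMap.adjoint QU w)) - Q1 (G1 (LinearMap.adjoint Q1 w)) := fun w => by
    rw [hXcl, LinearMap.coe_toContinuousLinearMap', LinearMap.sub_apply]; rfl
  have hid : KU z - K1 z = -((KUcl ∘L (Xcl ∘L K1cl)) z) := by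
    rw [ContinuousLinearMap.comp_apply, ContinuousLinearMap.comp_apply, hK1cl, LinearMap.coe_toContinuousLinearMap', eX, hKUcl,
      LinearMap.coe_toContinuousLinearMap', map_sub, hLU', e3]
    abel
  rw [hid, show WL2.equiv ℂ (fun _ : Bond d m => c₁) W (-((KUcl ∘L (Xcl ∘L K1cl)) z)) c =
      -(WL2.equiv ℂ (fun _ : Bond d m => c₁) W ((KUcl ∘L (Xcl ∘L K1cl)) z) c) from rfl, norm_neg]
  refine hc2.trans (le_of_eq ?_)
  simp only [hpiC]
  ring

end Literature.MathematicalPhysics.QuantumFieldTheory.Balaban1983to89.B9Eq3126KinvTwoBackgroundLetterTower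

end
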